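/-
COR-CM (cell pub-hodgecm2, stage 2 of the Hodge ladder) — count-neutral kernel combinatorics (seat prover-pub-hodgecm2-b23-g57-0, binder
prover b23, gen 57; lane SYLOW TRANSFER XV «order 8m — the reflected odd part», blanket `Census/SylowTransfer*` HOME/INBOX.md l.23357, claim l.26753).
Theorems only, in seat b09's intrinsic model (consumed BY NAME, nothing restated); no definition, no certificate, no `decide`, no named fact, no
geometry, no `sorry`.  `Interfaces.lean` (C1), every E term, B01 and `Transposition/*` are untouched.
HONEST FRAMING: `HC_CM` is NOT proved, here or anywhere in the tree; nothing here is a period or a headline.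
-/
import Summits.HodgeConjecture.CorCM.Census.SylowTransferShearedElements

/-!
# Sylow transfer, XV: order `8m` with a REFLECTED odd part — `μ(G, c) = φ₂(G, c)`

Gen 53ʼs part XIII (`isLeast_card_gfaces_generate_fibreTwo_of_normal_zpowers_prime_pow`) settles every group of order `8pᵏ` with a normal cyclic
subgroup `⟨z⟩` of order `pᵏ`: since `Aut(ℤ/pᵏ)` is cyclic, every element of `2`-power order acts on `⟨z⟩` by `±1`.  For a composite odd `m` the
group `Aut(ℤ/m) = (ℤ/m)ˣ` has involutions other than `−1` (e.g. `z ↦ z¹¹` on `ℤ/15`), and these «mixed» actions are exactly where the open rows of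
order `8m` live (gen 56ʼs mixed twists `D(ℤ/4m₂) × C_{m₁}`, `X_{m₂} × C_{m₁}`, …).  This file isolates the hypothesis that makes gen 53ʼs dispatch
work for EVERY odd `m`:

* §1 `conj_pow_eq_or_of_conj_eq_or`: if `w z w⁻¹ ∈ {z, z⁻¹}` then `w zⁿ w⁻¹ ∈ {zⁿ, (zⁿ)⁻¹}`.
* §2 **THE REFLECTED LAW** (`isLeast_card_gfaces_generate_fibreTwo_of_reflected`): `|G| = 8m` (`m ≥ 3` odd), `z ∈ G` of order `m` such that EVERY
  conjugate of `z` is `z` or `z⁻¹` (so `⟨z⟩ ⊴ G` and `G` acts on it through `{±1}`), `c` a central involution `≠ 1` ⟹ **`μ(G, c) = φ₂(G, c)`**.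
  DISPATCH (gen 53ʼs, verbatim up to the closing law): Sylow `2`-subgroup `P ∋ c`; `P` abelian ⟹ gen 51 VII; else `y ∈ P` with `y² = c`; if `y`
  centralises `z` then `u = y z` has order `4m` and the conjugates of `u⁴ = z⁴` are `z^{±4}` ⟹ gen 52ʼs dichotomy law
  `isLeast_card_gfaces_generate_fibreTwo_of_orderOf_four_mul_odd`; else `y` inverts `z`, some `s ∈ P ∖ ⟨y⟩` centralises `z` and inverts `y`, and
  either `s² = 1` (gen 53ʼs sheared datum from elements ⟹ gen 52ʼs sheared dihedral law) or `s` has order `4` (again an element `s z` of order `4m`).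
* §3 **COROLLARIES**: `z` CENTRAL of order `m` (`…_of_central_odd`; every `P × C_m` for the five groups `P` of order `8`, classification-free, and every
  group of order `8m` with a central element of order `m`); the `Type`-level form for every odd `m` including `m = 1` (`…_of_central_odd'`); the
  prime-power case is gen 53ʼs part XIII.
All [folklore] bookkeeping over [Pohlmann1968, Thm 1] in the reading of [Milne1999, Prop. 2.1].

## References
* [Pohlmann1968] H. Pohlmann, Algebraic cycles on abelian varieties of complex multiplication type, Ann. of Math. 88 (1968), Thm 1.
* [Milne1999] J. S. Milne, Lefschetz motives and the Tate conjecture, Compositio Math. 117 (1999), Prop. 2.1, p. 54.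
-/

namespace Summit.HodgeConjecture.CorCM.Census.SylowTransfer

open Finset
open Summit.HodgeConjecture.CorCM.Prior.AllgGroup.RfwfAllgGroup
open Summit.HodgeConjecture.CorCM.Census.BlockParity
open Summit.HodgeConjecture.CorCM.Census.Coinvariant

noncomputable section

section Group

variable {G : Type*} [Group G]

/-! ## §1 Reflected elements -/

/-- **Powers of a reflected element are reflected**: if `w z w⁻¹ ∈ {z, z⁻¹}` then `w zⁿ w⁻¹ ∈ {zⁿ, (zⁿ)⁻¹}`. [folklore] -/
theorem conj_pow_eq_or_of_conj_eq_or {z w : G} (h : w * z * w⁻¹ = z ∨ w * z * w⁻¹ = z⁻¹) (n : ℕ) :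
    w * z ^ n * w⁻¹ = z ^ n ∨ w * z ^ n * w⁻¹ = (z ^ n)⁻¹ := by
  have e : w * z ^ n * w⁻¹ = (w * z * w⁻¹) ^ n := by
    rw [← MulAut.conj_apply, ← MulAut.conj_apply, map_pow]
  rw [e]
  rcases h with h | h
  · exact Or.inl (by rw [h])
  · exact Or.inr (by rw [h, inv_pow])

/-- A reflected element generates a NORMAL cyclic subgroup: every conjugate of `z` lies in `⟨z⟩`. [folklore] -/
theorem conj_mem_zpowers_of_conj_eq_or {z : G} (h : ∀ w : G, w * z * w⁻¹ = z ∨ w * z * w⁻¹ = z⁻¹) (w : G) :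
    w * z * w⁻¹ ∈ Subgroup.zpowers z := by
  rcases h w with hw | hw
  · rw [hw]; exact Subgroup.mem_zpowers z
  · rw [hw]; exact Subgroup.inv_mem _ (Subgroup.mem_zpowers z)

/-- A central element is reflected (trivially). [folklore] -/
theorem conj_eq_or_of_central {z : G} (h : ∀ w : G, w * z = z * w) (w : G) : w * z * w⁻¹ = z ∨ w * z * w⁻¹ = z⁻¹ :=
  Or.inl (by rw [h w, mul_inv_cancel_right])

end Group

variable {G : Type*} [Group G] [Fintype G] [DecidableEq G]

/-! ## §2 The reflected law -/

/-- **THE REFLECTED LAW.**  `|G| = 8m` (`m ≥ 3` odd), `z` of order `m` with every conjugate of `z` equal to `z` or `z⁻¹`, `c ≠ 1` a central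
involution: **`μ(G, c) = φ₂(G, c)`** — the least number of faces whose base changes, together with the pairs, generate the Hodge lattice is the
coinvariant fibre.  Gen 53ʼs part XIII is the case `m = pᵏ` (there the hypothesis is automatic). [folklore] -/
theorem isLeast_card_gfaces_generate_fibreTwo_of_reflected (c : G) {m : ℕ} (hm : Odd m) (h3 : 3 ≤ m)
    (hG : Fintype.card G = 8 * m) (z : G) (hz : orderOf z = m)
    (hrefl : ∀ w : G, w * z * w⁻¹ = z ∨ w * z * w⁻¹ = z⁻¹)
    (hc2 : c * c = 1) (hc1 : c ≠ 1) (hcen : ∀ w : G, w * c = c * w) :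
    IsLeast {n : ℕ | ∃ S : Finset (CMF G c →₀ ℤ), (↑S ⊆ gfaceSet G c hc2) ∧ S.card = n ∧
      hodgeSpan c hc2 ≤ Submodule.span ℤ (pairSet c) ⊔ Submodule.span ℤ (translates c S)} (fibreTwo c hc2) := by
  haveI : Fact (Nat.Prime 2) := ⟨Nat.prime_two⟩
  have hm1 : m ≠ 1 := by omega
  have hcinv : c⁻¹ = c := inv_eq_of_mul_eq_one_right hc2
  obtain ⟨P⟩ := (Sylow.nonempty : Nonempty (Sylow 2 G))
  obtain ⟨hP8, -⟩ := card_sylow_eq_eight P hG hm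
  have hcP : c ∈ (P : Subgroup G) := TypeStabiliser.mem_sylow_of_central c hc2 hcen P
  by_cases hcomm : ∀ a ∈ (P : Subgroup G), ∀ b ∈ (P : Subgroup G), a * b = b * a
  · exact isLeast_card_gfaces_generate_fibreTwo_of_card_eq_eight_mul_odd_comm c hG hm hm1 P hcomm hc2 hc1 hcen
  -- non-abelian Sylow `2`-subgroup: `y² = c`
  obtain ⟨y, hyP, hyy⟩ := exists_sq_of_card_eight_not_comm c hP8 hcomm hcP hc2 hc1 hcen
  have hy2 : y ^ 2 = c := by rw [pow_two, hyy]
  have hordy : orderOf y = 4 := by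
    have h := orderOf_eq_prime_pow (p := 2) (n := 1) (x := y) (by rw [pow_one, hy2]; exact hc1)
      (by rw [show 2 ^ (1 + 1) = 2 * 2 by norm_num, pow_mul, hy2, pow_two, hc2])
    simpa using h
  -- coprimality `4 ⊥ m`
  have hcop : Nat.Coprime 4 m := by
    rw [show (4 : ℕ) = 2 ^ 2 by norm_num]
    exact Nat.Coprime.pow_left _ (Nat.coprime_two_left.mpr hm)
  -- an element `t ∈ P` of order `4` centralising `z` gives `u = t z` of order `4m` whose fourth power `z⁴` is reflected
  have hfour : ∀ t : G, orderOf t = 4 → t * z * t⁻¹ = z →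
      IsLeast {n : ℕ | ∃ S : Finset (CMF G c →₀ ℤ), (↑S ⊆ gfaceSet G c hc2) ∧ S.card = n ∧
        hodgeSpan c hc2 ≤ Submodule.span ℤ (pairSet c) ⊔ Submodule.span ℤ (translates c S)} (fibreTwo c hc2) := by
    intro t hordt htz
    have hc' : Commute t z := mul_inv_eq_iff_eq_mul.mp htz
    have hordu : orderOf (t * z) = 4 * m := by
      rw [hc'.orderOf_mul_eq_mul_orderOf_of_coprime (by rw [hordt, hz]; exact hcop), hordt, hz]
    have hu4 : (t * z) ^ 4 = z ^ 4 := by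
      rw [hc'.mul_pow, ← hordt, pow_orderOf_eq_one, one_mul]
    refine isLeast_card_gfaces_generate_fibreTwo_of_orderOf_four_mul_odd c hm h3 hG (t * z) hordu (fun w => ?_) hc2 hc1 hcen
    rw [hu4]
    exact conj_pow_eq_or_of_conj_eq_or (hrefl w) 4
  rcases hrefl y with hyz | hyz
  · -- `y` centralises `z`
    exact hfour y hordy hyz
  · -- `y` inverts `z`; an element of `P ∖ ⟨y⟩` centralising `z`
    obtain ⟨x₀, hx₀P, hx₀⟩ := exists_notMem_zpowers_of_card_eight hP8 hordy
    obtain ⟨s, hsP, hsy', hsz⟩ : ∃ s ∈ (P : Subgroup G), s ∉ Subgroup.zpowers y ∧ s * z * s⁻¹ = z := by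
      rcases hrefl x₀ with h | h
      · exact ⟨x₀, hx₀P, hx₀, h⟩
      · refine ⟨x₀ * y, mul_mem hx₀P hyP, fun hmem => hx₀ ?_, ?_⟩
        · have : x₀ = x₀ * y * y⁻¹ := by rw [mul_inv_cancel_right]
          rw [this]
          exact mul_mem hmem (inv_mem (Subgroup.mem_zpowers y))
        · calc x₀ * y * z * (x₀ * y)⁻¹ = x₀ * (y * z * y⁻¹) * x₀⁻¹ := by group
            _ = x₀ * z⁻¹ * x₀⁻¹ := by rw [hyz]
            _ = (x₀ * z * x₀⁻¹)⁻¹ := by group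
            _ = z := by rw [h, inv_inv]
    obtain ⟨hsy, hs2⟩ := conj_eq_inv_and_sq_of_card_eight_not_comm hP8 hcomm hyP hsP hordy hsy'
    rcases hs2 with hs2 | hs2
    · -- `s` is an involution: the sheared datum from elements
      exact isLeast_card_gfaces_generate_fibreTwo_of_sheared_elements c hm h3 hG z y s hz hyy hyz hs2
        (mul_inv_eq_iff_eq_mul.mp hsz) hsy hc2 hc1 hcen
    · -- `s` has order `4` and centralises `z`
      rw [hy2] at hs2
      have hords : orderOf s = 4 := by
        have h := orderOf_eq_prime_pow (p := 2) (n := 1) (x := s) (by rw [pow_one, pow_two, hs2]; exact hc1)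
          (by rw [show 2 ^ (1 + 1) = 2 * 2 by norm_num, pow_mul, pow_two s, hs2, pow_two, hc2])
        simpa using h
      exact hfour s hords hsz

/-- **THE REFLECTED LAW, normal-subgroup form**: `|G| = 8m` (`m ≥ 3` odd), `z` of order `m`, and `G` acts on `⟨z⟩` through `{±1}` — stated as
«every `w` satisfies `w z w⁻¹ = z` or `w z⁻¹ w⁻¹ = z`… » no: as «`w z w⁻¹ = z ^ k` with `k ∈ {1, m − 1}`». [folklore] -/
theorem isLeast_card_gfaces_generate_fibreTwo_of_conj_eq_pow (c : G) {m : ℕ} (hm : Odd m) (h3 : 3 ≤ m)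
    (hG : Fintype.card G = 8 * m) (z : G) (hz : orderOf z = m)
    (hrefl : ∀ w : G, ∃ k : ℕ, (k = 1 ∨ k = m - 1) ∧ w * z * w⁻¹ = z ^ k)
    (hc2 : c * c = 1) (hc1 : c ≠ 1) (hcen : ∀ w : G, w * c = c * w) :
    IsLeast {n : ℕ | ∃ S : Finset (CMF G c →₀ ℤ), (↑S ⊆ gfaceSet G c hc2) ∧ S.card = n ∧
      hodgeSpan c hc2 ≤ Submodule.span ℤ (pairSet c) ⊔ Submodule.span ℤ (translates c S)} (fibreTwo c hc2) := by
  refine isLeast_card_gfaces_generate_fibreTwo_of_reflected c hm h3 hG z hz (fun w => ?_) hc2 hc1 hcen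
  obtain ⟨k, hk, hw⟩ := hrefl w
  rcases hk with rfl | rfl
  · exact Or.inl (by rw [hw, pow_one])
  · right
    rw [hw]
    have hzm : z ^ m = 1 := by rw [← hz, pow_orderOf_eq_one]
    have : z ^ (m - 1) * z = 1 := by rw [← pow_succ, Nat.sub_add_cancel (by omega), hzm]
    exact eq_inv_of_mul_eq_one_left this

/-! ## §3 Corollaries: a central element of order `m` -/

/-- **ORDER `8m` WITH A CENTRAL ELEMENT OF ORDER `m` (`m ≥ 3` odd), EVERY CENTRAL INVOLUTION: `μ(G, c) = φ₂(G, c)`** — in particular every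
`P × C_m` for the five groups `P` of order `8`, classification-free (the Sylow `2`-subgroup of such a `G` is a direct factor). [folklore] -/
theorem isLeast_card_gfaces_generate_fibreTwo_of_central_odd (c : G) {m : ℕ} (hm : Odd m) (h3 : 3 ≤ m)
    (hG : Fintype.card G = 8 * m) (z : G) (hz : orderOf z = m) (hzc : ∀ w : G, w * z = z * w)
    (hc2 : c * c = 1) (hc1 : c ≠ 1) (hcen : ∀ w : G, w * c = c * w) :
    IsLeast {n : ℕ | ∃ S : Finset (CMF G c →₀ ℤ), (↑S ⊆ gfaceSet G c hc2) ∧ S.card = n ∧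
      hodgeSpan c hc2 ≤ Submodule.span ℤ (pairSet c) ⊔ Submodule.span ℤ (translates c S)} (fibreTwo c hc2) :=
  isLeast_card_gfaces_generate_fibreTwo_of_reflected c hm h3 hG z hz (conj_eq_or_of_central hzc) hc2 hc1 hcen

/-- **… every odd `m`, including `m = 1`** (`G : Type`; order `8` is gen 50ʼs `IndexTwoCyclic.isLeast_card_gfaces_generate_fibreTwo_of_card_eq_eight`).
[folklore] -/
theorem isLeast_card_gfaces_generate_fibreTwo_of_central_odd' {G : Type} [Group G] [Fintype G] [DecidableEq G] (c : G) {m : ℕ}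
    (hm : Odd m) (hG : Fintype.card G = 8 * m) (z : G) (hz : orderOf z = m) (hzc : ∀ w : G, w * z = z * w)
    (hc2 : c * c = 1) (hc1 : c ≠ 1) (hcen : ∀ w : G, w * c = c * w) :
    IsLeast {n : ℕ | ∃ S : Finset (CMF G c →₀ ℤ), (↑S ⊆ gfaceSet G c hc2) ∧ S.card = n ∧
      hodgeSpan c hc2 ≤ Submodule.span ℤ (pairSet c) ⊔ Submodule.span ℤ (translates c S)} (fibreTwo c hc2) := by
  by_cases h1 : m = 1
  · subst h1
    exact IndexTwoCyclic.isLeast_card_gfaces_generate_fibreTwo_of_card_eq_eight hc2 hc1 hcen (by rw [hG])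
  · have h3 : 3 ≤ m := by
      obtain ⟨k, rfl⟩ := hm
      omega
    exact isLeast_card_gfaces_generate_fibreTwo_of_central_odd c hm h3 hG z hz hzc hc2 hc1 hcen

/-- **… reflected, every odd `m` including `m = 1`** (`G : Type`). [folklore] -/
theorem isLeast_card_gfaces_generate_fibreTwo_of_reflected' {G : Type} [Group G] [Fintype G] [DecidableEq G] (c : G) {m : ℕ}
    (hm : Odd m) (hG : Fintype.card G = 8 * m) (z : G) (hz : orderOf z = m)
    (hrefl : ∀ w : G, w * z * w⁻¹ = z ∨ w * z * w⁻¹ = z⁻¹)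
    (hc2 : c * c = 1) (hc1 : c ≠ 1) (hcen : ∀ w : G, w * c = c * w) :
    IsLeast {n : ℕ | ∃ S : Finset (CMF G c →₀ ℤ), (↑S ⊆ gfaceSet G c hc2) ∧ S.card = n ∧
      hodgeSpan c hc2 ≤ Submodule.span ℤ (pairSet c) ⊔ Submodule.span ℤ (translates c S)} (fibreTwo c hc2) := by
  by_cases h1 : m = 1
  · subst h1
    exact IndexTwoCyclic.isLeast_card_gfaces_generate_fibreTwo_of_card_eq_eight hc2 hc1 hcen (by rw [hG])
  · have h3 : 3 ≤ m := by
      obtain ⟨k, rfl⟩ := hm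
      omega
    exact isLeast_card_gfaces_generate_fibreTwo_of_reflected c hm h3 hG z hz hrefl hc2 hc1 hcen

/-- **PRODUCT FORM**: `G = P × C` with `|P| = 8` and `C` of odd order `m` cyclic (generated by `z₀`), `c = (c₀, 1)` with `c₀` a central
involution of `P`: `μ(G, c) = φ₂(G, c)` — e.g. `D₄ × ℤ/m` (gen 45ʼs octic product, `ζ = 0`), `Q₈ × ℤ/m` (`ζ = 1`), `ℤ/8 × ℤ/m`, `(ℤ/4 × ℤ/2) × ℤ/m`,
`(ℤ/2)³ × ℤ/m`, uniformly and for every odd `m`. [folklore] -/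
theorem isLeast_card_gfaces_generate_fibreTwo_prod_cyclic_odd {P C : Type} [Group P] [Fintype P] [DecidableEq P] [CommGroup C] [Fintype C]
    [DecidableEq C] (c₀ : P) (hP : Fintype.card P = 8) {m : ℕ} (hm : Odd m) (hC : Fintype.card C = m) (z₀ : C) (hz₀ : orderOf z₀ = m)
    (hc2 : c₀ * c₀ = 1) (hc1 : c₀ ≠ 1) (hcen : ∀ w : P, w * c₀ = c₀ * w) :
    IsLeast {n : ℕ | ∃ S : Finset (CMF (P × C) (c₀, 1) →₀ ℤ), (↑S ⊆ gfaceSet (P × C) (c₀, 1) (by rw [Prod.mk_mul_mk, hc2, mul_one]; rfl)) ∧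
      S.card = n ∧ hodgeSpan (c₀, 1) (by rw [Prod.mk_mul_mk, hc2, mul_one]; rfl) ≤
        Submodule.span ℤ (pairSet (c₀, (1 : C))) ⊔ Submodule.span ℤ (translates (c₀, 1) S)}
      (fibreTwo ((c₀, 1) : P × C) (by rw [Prod.mk_mul_mk, hc2, mul_one]; rfl)) := by
  refine isLeast_card_gfaces_generate_fibreTwo_of_central_odd' (c₀, (1 : C)) hm ?_ ((1 : P), z₀) ?_ (fun w => ?_) _ ?_ (fun w => ?_)
  · rw [Fintype.card_prod, hP, hC]
  · rw [Prod.orderOf_mk, orderOf_one, hz₀, Nat.lcm_one_left]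
  · obtain ⟨p, x⟩ := w
    rw [Prod.mk_mul_mk, Prod.mk_mul_mk, mul_one, one_mul, mul_comm x]
  · intro h
    exact hc1 (Prod.mk.inj h).1
  · obtain ⟨p, x⟩ := w
    rw [Prod.mk_mul_mk, Prod.mk_mul_mk, mul_one, one_mul, hcen]

end

end Summit.HodgeConjecture.CorCM.Census.SylowTransfer
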